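import Literature.Computability.Complexity.BooleanFourier
import Literature.Probability.Entropy.FiniteShannonIndependence
import Literature.Probability.Entropy.PinskerInequality
import HarnessLib

/-!
# Chang's inequality for bounded densities on the cube (entropy form) and the junta lemma of
# Chan–Lee–Raghavendra–Steurer (Lemma 3.3)

Topic `Literature/Probability/Moments` (companion of `BiasedCubeLevelOne.lean`, which proves the
level-1 / Chang inequality for INDICATORS of sets on the biased cube by the entropy argument of
Impagliazzo–Moore–Russell).  Here the same entropy argument is run for an arbitrary bounded DENSITY
`q : {0,1}^m → ℝ_{≥0}`, `E q = 1`, `q ≤ K` pointwise (so the law `μ_q = q · 2^{-m}` has min-entropy,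
hence Shannon entropy, at least `m log 2 − log K`), which is the form used by
Chan–Lee–Raghavendra–Steurer [ChanEtAl2016, §3.1, Remark 3.4: "The claim in [IMR14] is only stated
for … the (scaled) characteristic function of a subset … but the proof only uses the entropy of q"]:

* `IsTriangular` — a list of pairs (set `α_i ⊆ [m]`, pivot `p_i ∈ α_i`), LATEST FIRST, whose pivots
  avoid every set further down the list (every earlier-chosen set).  Such families are what a greedy
  selection produces and they are linearly independent over `𝔽₂`; we never use linear algebra: the
  triangular structure makes `x ↦ ((χ_{α_i}(x))_i, x|_{[m] ∖ pivots})` injective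
  (`IsTriangular.eq_of_agree`), which is all the entropy argument needs.
* `sum_sq_cubeFourierCoeff_le_of_isTriangular` — **Chang's inequality, entropy form**
  [cite: ImpagliazzoMooreRussell2014, Lemma 1] [cite: ChanEtAl2016, Lemma 3.3 / Remark 3.4 (arXiv v3 p. 9)]:
  for a density `q ≤ K` and a triangular family, `Σ_i q̂(α_i)² ≤ 2 log K` (natural logarithm; for
  `K = 2^t` this is `(2 ln 2)·t ≤ 2t`, the printed `|S'| ≤ 2γ^{-2} t` once every `|q̂(α_i)| > γ`).
  PROOF (IMR14): with `μ = μ_q` on `{0,1}^m`, `H[x] ≥ m log 2 − log K` (atoms `≤ K 2^{-m}`,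
  `neg_log_le_ent`); `x` is determined by the parities `Z_i = [χ_{α_i}(x) = −1]` and the off-pivot
  coordinates `W`, so `H[x] ≤ H[Z] + H[W] ≤ Σ_i H[Z_i] + (m − r) log 2` (`ent_le_ent_of_determines`,
  `ent_pair_le_add`, `ent_le_log_card`); and `H[Z_i] ≤ log 2 − q̂(α_i)²/2` by Pinsker for
  `Ber(p_i)` versus `Ber(1/2)`, `q̂(α_i) = 1 − 2 p_i`.
* `exists_triangular_cover` — greedy: for any finite family `F` of subsets of `[m]` there is a
  triangular list of members of `F` whose union contains every member of `F`.
* `ChanEtAl2016_lemma33` — **CLRS Lemma 3.3** [cite: ChanEtAl2016, Lemma 3.3 (arXiv v3 p. 9)]: for a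
  density `q ≤ K`, every `d` and `γ > 0` there is `J ⊆ [m]` with `|J| ≤ d · (2 log K)/γ²` such that
  `|q̂(α)| ≤ γ` for every `α ⊄ J` with `|α| ≤ d` (printed: entropy `≥ n − t`, `|J| ≤ 2td/γ²`; here
  `K = 2^t` gives `2 t d ln 2/γ² ≤ 2td/γ²`, `ChanEtAl2016_lemma33_pow`).

Everything is PROVED (finite sums; 0 named facts, no new definitions beyond the two pieces of
bookkeeping vocabulary `oddOn`, `IsTriangular`, `unionList`).  Vocabulary: `walsh`, `sgn`
(`Literature.Probability.RandomGraphs.LowDegree`), `cubeFourierCoeff`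
(`Literature.Computability.Complexity.LowDegree`, `q̂(S) = 2^{-m} Σ_x q(x) χ_S(x)`), and the finite
Shannon entropy `ent`/`prob`/`mass` of `Literature.Probability.Entropy.FiniteShannon`.

## References
* R. Impagliazzo, C. Moore, A. Russell, *An entropic proof of Chang's inequality*, SIAM J. Discrete
  Math. 28 (2014) 173–176, Lemma 1 [ImpagliazzoMooreRussell2014].
* S. O. Chan, J. R. Lee, P. Raghavendra, D. Steurer, *Approximate constraint satisfaction requires
  large LP relaxations*, J. ACM 63 (2016) / FOCS 2013; arXiv:1309.0563v3 §3.1, Lemma 3.3 and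
  Remark 3.4 (p. 9) [ChanEtAl2016].
-/

noncomputable section

namespace Literature.Probability.Moments

open Finset Real
open Literature.Probability.RandomGraphs.LowDegree (walsh sgn sgn_true sgn_false sgn_mul_self)
open Literature.Computability.Complexity.LowDegree (cubeFourierCoeff)
open Literature.Probability.Entropy Literature.Probability.Entropy.FiniteShannon

variable {m : ℕ}

/-! ### Characters and parities -/

/-- `χ_A(x)² = 1`. [folklore] -/
private theorem walsh_mul_self' (A : Finset (Fin m)) (x : Fin m → Bool) : walsh A x * walsh A x = 1 := by
  unfold walsh
  rw [← prod_mul_distrib]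
  exact prod_eq_one fun i _ => sgn_mul_self (x i)

/-- `χ_A(x) ∈ {1, −1}`. [folklore] -/
private theorem walsh_eq_one_or (A : Finset (Fin m)) (x : Fin m → Bool) : walsh A x = 1 ∨ walsh A x = -1 := by
  have h := walsh_mul_self' A x
  have : (walsh A x - 1) * (walsh A x + 1) = 0 := by ring_nf; linarith
  rcases mul_eq_zero.1 this with h1 | h1
  · left; linarith
  · right; linarith

/-- The parity of `x` on `A`, as a Boolean: `true` iff `χ_A(x) = −1` (an odd number of `true`
coordinates in `A`). [folklore] -/
def oddOn (A : Finset (Fin m)) (x : Fin m → Bool) : Bool := decide (walsh A x = -1)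

/-- `χ_A(x) = sgn(oddOn A x)` (`sgn true = −1`, `sgn false = 1`). [folklore] -/
private theorem walsh_eq_sgn_oddOn (A : Finset (Fin m)) (x : Fin m → Bool) :
    walsh A x = sgn (oddOn A x) := by
  unfold oddOn
  rcases walsh_eq_one_or A x with h | h
  · rw [h]; norm_num [sgn]
  · rw [h]; simp [sgn]

/-- Removing a point of `A`: `χ_A(x) = sgn(x_p) · χ_{A ∖ p}(x)`. [folklore] -/
private theorem walsh_eq_sgn_mul_erase {A : Finset (Fin m)} {p : Fin m} (hp : p ∈ A) (x : Fin m → Bool) :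
    walsh A x = sgn (x p) * walsh (A.erase p) x := by
  unfold walsh
  rw [mul_prod_erase A (fun i => sgn (x i)) hp]

/-- `sgn` is injective on `Bool`. [folklore] -/
private theorem sgn_injective : Function.Injective sgn := by
  intro a b h
  cases a <;> cases b <;> simp [sgn] at h ⊢ <;> linarith

/-- If `x, y` agree on `A ∖ {p}` (`p ∈ A`) and have the same parity on `A`, they agree at `p`.
[folklore] -/
private theorem eq_of_walsh_eq_of_agree_erase {A : Finset (Fin m)} {p : Fin m} (hp : p ∈ A)
    {x y : Fin m → Bool} (hag : ∀ i ∈ A.erase p, x i = y i) (hpar : walsh A x = walsh A y) :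
    x p = y p := by
  rw [walsh_eq_sgn_mul_erase hp x, walsh_eq_sgn_mul_erase hp y] at hpar
  have he : walsh (A.erase p) x = walsh (A.erase p) y :=
    prod_congr rfl fun i hi => by rw [hag i hi]
  rw [he] at hpar
  have hne : walsh (A.erase p) y ≠ 0 := by
    rcases walsh_eq_one_or (A.erase p) y with h | h <;> rw [h] <;> norm_num
  exact sgn_injective (mul_right_cancel₀ hne hpar)

/-- Changing `x` outside `A` does not change `χ_A(x)`. [folklore] -/
private theorem walsh_congr {A : Finset (Fin m)} {x y : Fin m → Bool} (h : ∀ i ∈ A, x i = y i) :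
    walsh A x = walsh A y :=
  prod_congr rfl fun i hi => by rw [h i hi]

/-! ### Triangular families -/

/-- A **triangular family**: a list of pairs `(α, p)` with `p ∈ α`, listed LATEST FIRST, such that
each pivot `p` lies in no set FURTHER DOWN the list (in no earlier-chosen set).  Greedy selections
("pick a set not covered by the union of the sets chosen so far, with a pivot outside that union")
are triangular. [cite: ChanEtAl2016, Lemma 3.3 proof (arXiv v3 p. 9: "a maximal set of linearly independent elements")] -/
def IsTriangular (L : List (Finset (Fin m) × Fin m)) : Prop :=
  (∀ e ∈ L, e.2 ∈ e.1) ∧ L.Pairwise (fun e e' => e.2 ∉ e'.1)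

/-- The empty family is triangular. [folklore] -/
private theorem isTriangular_nil : IsTriangular ([] : List (Finset (Fin m) × Fin m)) :=
  ⟨fun _ h => by simp at h, List.Pairwise.nil⟩

/-- Unfolding `IsTriangular` on a cons. [folklore] -/
private theorem isTriangular_cons {e : Finset (Fin m) × Fin m} {L : List (Finset (Fin m) × Fin m)} :
    IsTriangular (e :: L) ↔ e.2 ∈ e.1 ∧ (∀ e' ∈ L, e.2 ∉ e'.1) ∧ IsTriangular L := by
  unfold IsTriangular
  rw [List.pairwise_cons]
  constructor
  · rintro ⟨h1, h2, h3⟩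
    exact ⟨h1 e (by simp), h2, fun e' he' => h1 e' (by simp [he']), h3⟩
  · rintro ⟨h1, h2, h3, h4⟩
    refine ⟨fun e' he' => ?_, h2, h4⟩
    rcases List.mem_cons.1 he' with rfl | he'
    · exact h1
    · exact h3 e' he'

/-- Appending one pair at the END (an earlier-chosen set): triangularity is kept if the new pivot
lies in its set and the pivots already present avoid the new set. [folklore] -/
private theorem IsTriangular.append_singleton {L : List (Finset (Fin m) × Fin m)} (hL : IsTriangular L)
    {a : Finset (Fin m)} {p : Fin m} (hp : p ∈ a) (havoid : ∀ e ∈ L, e.2 ∉ a) :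
    IsTriangular (L ++ [(a, p)]) := by
  refine ⟨fun e he => ?_, ?_⟩
  · rcases List.mem_append.1 he with he | he
    · exact hL.1 e he
    · simp at he; rw [he]; exact hp
  · rw [List.pairwise_append]
    refine ⟨hL.2, List.pairwise_singleton _ _, fun e he e' he' => ?_⟩
    simp at he'; rw [he']; exact havoid e he

/-- The pivots of a triangular family are pairwise distinct. [folklore] -/
private theorem IsTriangular.nodup_map_snd {L : List (Finset (Fin m) × Fin m)} (hL : IsTriangular L) :
    (L.map Prod.snd).Nodup := by
  induction L with
  | nil => simp
  | cons e L ih =>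
    rw [isTriangular_cons] at hL
    rw [List.map_cons, List.nodup_cons]
    refine ⟨fun hmem => ?_, ih hL.2.2⟩
    obtain ⟨e', he', hee'⟩ := List.mem_map.1 hmem
    have h1 : e'.2 ∈ e'.1 := hL.2.2.1 e' he'
    rw [hee'] at h1
    exact hL.2.1 e' he' h1

/-- A triangular family on `[m]` has at most `m` members. [folklore] -/
private theorem IsTriangular.length_le {L : List (Finset (Fin m) × Fin m)} (hL : IsTriangular L) :
    L.length ≤ m := by
  have h := List.Nodup.length_le_card hL.nodup_map_snd
  simpa using h

/-- **Triangular solve**: a point of the cube is determined by its parities on the sets of a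
triangular family together with its coordinates off the pivots. [folklore] -/
private theorem IsTriangular.eq_of_agree {L : List (Finset (Fin m) × Fin m)} (hL : IsTriangular L)
    {x y : Fin m → Bool} (hpar : ∀ e ∈ L, walsh e.1 x = walsh e.1 y)
    (hoff : ∀ j, j ∉ L.map Prod.snd → x j = y j) : x = y := by
  induction L generalizing y with
  | nil => exact funext fun j => hoff j (by simp)
  | cons e L ih =>
    rw [isTriangular_cons] at hL
    obtain ⟨hpe, havoid, hL'⟩ := hL
    -- compare `x` with `y` corrected at the newest pivot
    set y' : Fin m → Bool := Function.update y e.2 (x e.2) with hy'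
    have hxy' : x = y' := by
      refine ih hL' (fun e' he' => ?_) (fun j hj => ?_)
      · rw [hpar e' (by simp [he'])]
        refine walsh_congr fun i hi => ?_
        have hne : i ≠ e.2 := fun h => havoid e' he' (h ▸ hi)
        rw [hy', Function.update_of_ne hne]
      · by_cases hje : j = e.2
        · rw [hje, hy', Function.update_self]
        · rw [hy', Function.update_of_ne hje]
          exact hoff j (by simp [hje, hj])
    -- `x` and `y` agree off `e.2`; the parity on `e.1` fixes the value at `e.2`
    have hag : ∀ i ∈ e.1.erase e.2, x i = y i := by
      intro i hi
      have hne : i ≠ e.2 := (mem_erase.1 hi).1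
      rw [hxy', hy', Function.update_of_ne hne]
    have hp : x e.2 = y e.2 := eq_of_walsh_eq_of_agree_erase hpe hag (hpar e (by simp))
    funext j
    by_cases hje : j = e.2
    · rw [hje]; exact hp
    · rw [hxy', hy', Function.update_of_ne hje]

/-! ### Unions of lists of sets -/

/-- The union of a list of finite sets. [folklore] -/
def unionList (l : List (Finset (Fin m))) : Finset (Fin m) := l.foldr (· ∪ ·) ∅

/-- `unionList [] = ∅`. [folklore] -/
@[simp] private theorem unionList_nil : unionList ([] : List (Finset (Fin m))) = ∅ := rfl

/-- `unionList (a :: l) = a ∪ unionList l`. [folklore] -/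
@[simp] private theorem unionList_cons (a : Finset (Fin m)) (l : List (Finset (Fin m))) :
    unionList (a :: l) = a ∪ unionList l := rfl

/-- Membership in the union of a list. [folklore] -/
private theorem mem_unionList {l : List (Finset (Fin m))} {j : Fin m} :
    j ∈ unionList l ↔ ∃ a ∈ l, j ∈ a := by
  induction l with
  | nil => simp
  | cons a l ih => simp [ih]

/-- `unionList (l ++ l') = unionList l ∪ unionList l'`. [folklore] -/
private theorem unionList_append (l l' : List (Finset (Fin m))) :
    unionList (l ++ l') = unionList l ∪ unionList l' := by
  ext j; simp only [mem_unionList, mem_union, List.mem_append]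
  constructor
  · rintro ⟨a, ha | ha, hj⟩
    · exact Or.inl ⟨a, ha, hj⟩
    · exact Or.inr ⟨a, ha, hj⟩
  · rintro (⟨a, ha, hj⟩ | ⟨a, ha, hj⟩)
    · exact ⟨a, Or.inl ha, hj⟩
    · exact ⟨a, Or.inr ha, hj⟩

/-- The union of a list of sets of size `≤ d` has size `≤ d · length`. [folklore] -/
private theorem card_unionList_le {l : List (Finset (Fin m))} {d : ℕ} (h : ∀ a ∈ l, a.card ≤ d) :
    (unionList l).card ≤ d * l.length := by
  induction l with
  | nil => simp
  | cons a l ih =>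
    rw [unionList_cons, List.length_cons]
    calc (a ∪ unionList l).card ≤ a.card + (unionList l).card := card_union_le _ _
      _ ≤ d + d * l.length := Nat.add_le_add (h a (by simp)) (ih fun b hb => h b (by simp [hb]))
      _ = d * (l.length + 1) := by ring

/-! ### Greedy triangular covers -/

/-- **Greedy cover**: for every finite family `F` of subsets of `[m]` and every `J ⊆ [m]` there is
a triangular list of members of `F`, with pivots outside `J`, whose union together with `J`
contains every member of `F`.  (Induction on `m − |J|`: if some `β ∈ F` is not inside `J`, choose
it with a pivot in `β ∖ J` and recurse with `J ∪ β`.)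
[cite: ChanEtAl2016, Lemma 3.3 proof (arXiv v3 p. 9: "Let S' ⊆ S denote a maximal set of linearly independent elements … J = ⋃_{α ∈ S'} α")] -/
theorem exists_triangular_cover (F : Finset (Finset (Fin m))) :
    ∀ (c : ℕ) (J : Finset (Fin m)), m - J.card ≤ c →
      ∃ L : List (Finset (Fin m) × Fin m), IsTriangular L ∧ (∀ e ∈ L, e.1 ∈ F ∧ e.2 ∉ J) ∧
        ∀ β ∈ F, β ⊆ J ∪ unionList (L.map Prod.fst) := by
  intro c
  induction c with
  | zero =>
    intro J hJ
    refine ⟨[], isTriangular_nil, fun e he => by simp at he, fun β _ => ?_⟩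
    have hJm : J.card = m := le_antisymm (by simpa using card_le_univ J) (by omega)
    have hJu : J = univ := eq_univ_of_card J (by simpa using hJm)
    rw [hJu]; exact fun j _ => mem_union_left _ (mem_univ j)
  | succ c ih =>
    intro J hJ
    by_cases hall : ∀ β ∈ F, β ⊆ J
    · exact ⟨[], isTriangular_nil, fun e he => by simp at he,
        fun β hβ j hj => mem_union_left _ (hall β hβ hj)⟩
    push Not at hall
    obtain ⟨α, hαF, hαJ⟩ := hall
    obtain ⟨p, hpα, hpJ⟩ := not_subset.1 hαJ
    have hcard : J.card < (J ∪ α).card :=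
      card_lt_card ⟨subset_union_left, fun h => hpJ (h (mem_union_right _ hpα))⟩
    have hle : (J ∪ α).card ≤ m := by simpa using card_le_univ (J ∪ α)
    obtain ⟨L, hL, hLF, hcov⟩ := ih (J ∪ α) (by omega)
    refine ⟨L ++ [(α, p)], hL.append_singleton hpα fun e he h => (hLF e he).2 (mem_union_right _ h),
      fun e he => ?_, fun β hβ j hj => ?_⟩
    · rcases List.mem_append.1 he with he | he
      · exact ⟨(hLF e he).1, fun h => (hLF e he).2 (mem_union_left _ h)⟩
      · simp at he; rw [he]; exact ⟨hαF, hpJ⟩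
    · have h := hcov β hβ hj
      rw [List.map_append, unionList_append]
      simp only [mem_union, List.map_cons, List.map_nil, unionList_cons, unionList_nil,
        union_empty] at h ⊢
      tauto

/-! ### The entropy argument -/

section Entropy

variable {q : (Fin m → Bool) → ℝ}

/-- The parities of `x` on the sets of `L`, as a list of Booleans. [folklore] -/
def parities (L : List (Finset (Fin m) × Fin m)) (x : Fin m → Bool) : List Bool :=
  L.map fun e => oddOn e.1 x

/-- For a density (`Σ_x q(x) = 2^m`) the total mass is `2^m`. [folklore] -/
private theorem mass_univ_eq (hq1 : ∑ x, q x = (2 : ℝ) ^ m) :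
    mass (univ : Finset (Fin m → Bool)) q = (2 : ℝ) ^ m := by
  rw [mass_def, hq1]

/-- The law of the point itself under `μ_q`: `P(x = a) = q(a) 2^{-m}`. [folklore] -/
private theorem prob_id_eq (hq1 : ∑ x, q x = (2 : ℝ) ^ m) (a : Fin m → Bool) :
    prob (univ : Finset (Fin m → Bool)) q id a = q a / 2 ^ m := by
  rw [prob_def, mass_univ_eq hq1]
  congr 1
  rw [mass_def]
  have : (univ : Finset (Fin m → Bool)).filter (fun i => id i = a) = {a} := by
    ext x; simp
  rw [this, sum_singleton]

/-- **Min-entropy bounds Shannon entropy**: if `q ≤ K` pointwise then `H_{μ_q}[x] ≥ m log 2 − log K`.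
[cite: ChanEtAl2016, §3.3 (arXiv v3 p. 10: "since ‖q_i‖_∞ ≤ 2^t, the entropy of μ_{q_i} is at least n − t")] -/
theorem ent_id_ge (hq0 : ∀ x, 0 ≤ q x) (hq1 : ∑ x, q x = (2 : ℝ) ^ m) {K : ℝ} (hK : 0 < K)
    (hqK : ∀ x, q x ≤ K) :
    m * Real.log 2 - Real.log K ≤ ent (univ : Finset (Fin m → Bool)) q id := by
  have hmass : 0 < mass (univ : Finset (Fin m → Bool)) q := by
    rw [mass_univ_eq hq1]; positivity
  have h := neg_log_le_ent (X := id) (fun x _ => hq0 x) hmass (q := K / 2 ^ m)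
    (fun a _ => by rw [prob_id_eq hq1]; gcongr; exact hqK a)
  have e : -Real.log (K / 2 ^ m) = m * Real.log 2 - Real.log K := by
    rw [Real.log_div hK.ne' (by positivity), Real.log_pow]; ring
  linarith

/-- The Fourier coefficient is the bias of the parity: `q̂(A) = 1 − 2 P(oddOn A = true)`.
[cite: ImpagliazzoMooreRussell2014, Lemma 1 (proof: the marginal biases)] -/
theorem cubeFourierCoeff_eq_one_sub_two_mul_prob (hq1 : ∑ x, q x = (2 : ℝ) ^ m)
    (A : Finset (Fin m)) :
    cubeFourierCoeff q A = 1 - 2 * prob (univ : Finset (Fin m → Bool)) q (oddOn A) true := by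
  have hmass : mass (univ : Finset (Fin m → Bool)) q = (2 : ℝ) ^ m := mass_univ_eq hq1
  have h2 : (2 : ℝ) ^ m ≠ 0 := by positivity
  rw [prob_eq_sum_ite, hmass]
  unfold cubeFourierCoeff
  have key : ∑ x, q x * walsh A x + 2 * (∑ i, if oddOn A i = true then q i else 0) = ∑ x, q x := by
    rw [mul_sum, ← sum_add_distrib]
    refine sum_congr rfl fun x _ => ?_
    rw [walsh_eq_sgn_oddOn]
    cases oddOn A x <;> simp [sgn]
    ring
  rw [hq1] at key
  field_simp
  linarith

/-- **Binary entropy versus bias**: `H[oddOn A] ≤ log 2 − q̂(A)²/2` (Pinsker for `Ber(p)` against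
`Ber(1/2)`: `log 2 − h(p) = kl(p ‖ ½) ≥ 2 (p − ½)²`, and `q̂(A) = 1 − 2p`).
[cite: ImpagliazzoMooreRussell2014, Lemma 1 (proof: 1 − H(p_i^+) ≥ bias²)] -/
theorem ent_oddOn_le (hq0 : ∀ x, 0 ≤ q x) (hq1 : ∑ x, q x = (2 : ℝ) ^ m) (A : Finset (Fin m)) :
    ent (univ : Finset (Fin m → Bool)) q (oddOn A) ≤
      Real.log 2 - cubeFourierCoeff q A ^ 2 / 2 := by
  have hw : ∀ x ∈ (univ : Finset (Fin m → Bool)), 0 ≤ q x := fun x _ => hq0 x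
  have hmass : 0 < mass (univ : Finset (Fin m → Bool)) q := by
    rw [mass_univ_eq hq1]; positivity
  set p : ℝ := prob (univ : Finset (Fin m → Bool)) q (oddOn A) true with hp
  have hp0 : 0 ≤ p := prob_nonneg hw _
  have hp1 : p ≤ 1 := prob_le_one hw _
  have hsum : ∑ b : Bool, prob (univ : Finset (Fin m → Bool)) q (oddOn A) b = 1 :=
    sum_prob_eq_one hmass (subset_univ _)
  rw [Fintype.sum_bool, ← hp] at hsum
  have hfalse : prob (univ : Finset (Fin m → Bool)) q (oddOn A) false = 1 - p := by linarith
  have hent : ent (univ : Finset (Fin m → Bool)) q (oddOn A) = negMulLog p + negMulLog (1 - p) := by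
    rw [ent_eq_sum_of_subset (subset_univ _), Fintype.sum_bool, ← hp, hfalse]
  have hcoef : cubeFourierCoeff q A = 1 - 2 * p := by
    rw [hp]; exact cubeFourierCoeff_eq_one_sub_two_mul_prob hq1 A
  rw [hent, hcoef]
  have hlog2 : (0.6931471803 : ℝ) < Real.log 2 := Real.log_two_gt_d9
  -- interior: Pinsker; endpoints: direct
  rcases hp0.eq_or_lt with h0 | hp0'
  · rw [← h0]; simp [negMulLog]; nlinarith
  rcases hp1.eq_or_lt with h1 | hp1'
  · rw [h1]; norm_num [negMulLog]; linarith
  have hpin := two_mul_sq_sub_le_binaryKL hp0' hp1' (by norm_num : (0:ℝ) < 1 / 2)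
    (by norm_num : (1 : ℝ) / 2 < 1)
  rw [binaryKL_eq p (by norm_num : (0:ℝ) < 1 / 2) (by norm_num : (1 : ℝ) / 2 < 1)] at hpin
  have e1 : Real.log (1 / 2 : ℝ) = -Real.log 2 := by
    rw [one_div, Real.log_inv]
  have e2 : Real.log (1 - 1 / 2 : ℝ) = -Real.log 2 := by norm_num [e1]
  rw [e1, e2] at hpin
  simp only [negMulLog]
  nlinarith

/-- **Subadditivity over a list**: `H[(oddOn α_i)_i] ≤ Σ_i H[oddOn α_i]` (the step
"`H(x) ≤ Σ_i H(marginals)`" of the entropic proof). [cite: ImpagliazzoMooreRussell2014, Lemma 1 (proof)] -/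
theorem ent_parities_le (hq0 : ∀ x, 0 ≤ q x) (L : List (Finset (Fin m) × Fin m)) :
    ent (univ : Finset (Fin m → Bool)) q (parities L) ≤
      (L.map fun e => ent (univ : Finset (Fin m → Bool)) q (oddOn e.1)).sum := by
  have hw : ∀ x ∈ (univ : Finset (Fin m → Bool)), 0 ≤ q x := fun x _ => hq0 x
  induction L with
  | nil =>
    simp only [List.map_nil, List.sum_nil]
    refine le_of_eq (ent_eq_zero_of_subsingleton hw (c := ([] : List Bool)) fun x _ => ?_)
    simp [parities]
  | cons e L ih =>
    rw [List.map_cons, List.sum_cons]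
    have hcomp : parities (e :: L) =
        (fun bl : Bool × List Bool => bl.1 :: bl.2) ∘ fun x => (oddOn e.1 x, parities L x) := by
      funext x; simp [parities]
    rw [hcomp, ent_comp_of_injOn (fun a _ b _ h => by
      simp only [List.cons.injEq] at h; exact Prod.ext h.1 h.2)]
    exact (ent_pair_le_add hw).trans (by linarith [ih])

/-- The sum of `log 2 − q̂²/2` over a list. [folklore] -/
private theorem sum_map_ent_oddOn_le (hq0 : ∀ x, 0 ≤ q x) (hq1 : ∑ x, q x = (2 : ℝ) ^ m)
    (L : List (Finset (Fin m) × Fin m)) :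
    (L.map fun e => ent (univ : Finset (Fin m → Bool)) q (oddOn e.1)).sum ≤
      L.length * Real.log 2 - (L.map fun e => cubeFourierCoeff q e.1 ^ 2).sum / 2 := by
  induction L with
  | nil => simp
  | cons e L ih =>
    simp only [List.map_cons, List.sum_cons, List.length_cons, Nat.cast_succ]
    have h := ent_oddOn_le hq0 hq1 e.1
    linarith

/-- **Chang's inequality for bounded densities, entropy form (Impagliazzo–Moore–Russell;
Chan–Lee–Raghavendra–Steurer Lemma 3.3 / Remark 3.4).**  If `q : {0,1}^m → [0, K]` has
`Σ_x q(x) = 2^m` (a density with `‖q‖_∞ ≤ K`) and `(α_i, p_i)_i` is a triangular family, then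
`Σ_i q̂(α_i)² ≤ 2 log K`.  In particular at most `2 log K / γ²` members of a triangular (e.g. a
maximal linearly independent) family of sets have `|q̂(α)| > γ`.
[cite: ImpagliazzoMooreRussell2014, Lemma 1] [cite: ChanEtAl2016, Lemma 3.3 and Remark 3.4 (arXiv v3 p. 9)] -/
theorem sum_sq_cubeFourierCoeff_le_of_isTriangular (hq0 : ∀ x, 0 ≤ q x)
    (hq1 : ∑ x, q x = (2 : ℝ) ^ m) {K : ℝ} (hqK : ∀ x, q x ≤ K)
    {L : List (Finset (Fin m) × Fin m)} (hL : IsTriangular L) :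
    (L.map fun e => cubeFourierCoeff q e.1 ^ 2).sum ≤ 2 * Real.log K := by
  classical
  have hw : ∀ x ∈ (univ : Finset (Fin m → Bool)), 0 ≤ q x := fun x _ => hq0 x
  -- `K > 0` since the total mass is positive
  have hK : 0 < K := by
    by_contra hK
    push Not at hK
    have : ∑ x : Fin m → Bool, q x ≤ 0 :=
      sum_nonpos fun x _ => (hqK x).trans hK
    rw [hq1] at this
    exact absurd this (not_le.2 (by positivity))
  -- the pivots and the off-pivot coordinates
  set piv : Finset (Fin m) := (L.map Prod.snd).toFinset with hpiv
  have hpivcard : piv.card = L.length := by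
    rw [hpiv, List.toFinset_card_of_nodup hL.nodup_map_snd, List.length_map]
  set W : (Fin m → Bool) → ({j : Fin m // j ∉ piv} → Bool) := fun x j => x j.1 with hW
  -- (1) lower bound on `H[x]`
  have h1 := ent_id_ge hq0 hq1 hK hqK
  -- (2) `x` is determined by (parities, W)
  have h2 : ent (univ : Finset (Fin m → Bool)) q id ≤
      ent (univ : Finset (Fin m → Bool)) q (fun x => (parities L x, W x)) := by
    refine ent_le_ent_of_determines hw fun x _ y _ hxy => ?_
    simp only [Prod.mk.injEq] at hxy
    change x = y
    refine hL.eq_of_agree (fun e he => ?_) (fun j hj => ?_)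
    · have hl := congrArg (fun l => l[L.idxOf e]?) hxy.1
      have hidx : L.idxOf e < L.length := List.idxOf_lt_length_of_mem he
      simp only [parities, List.getElem?_map, List.getElem?_eq_getElem hidx, List.getElem_idxOf hidx,
        Option.map_some, Option.some.injEq] at hl
      rw [walsh_eq_sgn_oddOn, walsh_eq_sgn_oddOn, hl]
    · have hj' : j ∉ piv := by rwa [hpiv, List.mem_toFinset]
      exact congrFun hxy.2 ⟨j, hj'⟩
  -- (3) subadditivity
  have h3 : ent (univ : Finset (Fin m → Bool)) q (fun x => (parities L x, W x)) ≤
      ent (univ : Finset (Fin m → Bool)) q (parities L) + ent (univ : Finset (Fin m → Bool)) q W :=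
    ent_pair_le_add hw
  -- (4) `H[W] ≤ (m − r) log 2`
  have h4 : ent (univ : Finset (Fin m → Bool)) q W ≤ (m - L.length : ℝ) * Real.log 2 := by
    have h := ent_le_log_card (X := W) hw (subset_univ _)
    have hcard : ((univ : Finset ({j : Fin m // j ∉ piv} → Bool)).card : ℝ) =
        (2 : ℝ) ^ (m - L.length) := by
      rw [card_univ, Fintype.card_fun, Fintype.card_bool, Fintype.card_subtype_compl,
        Fintype.card_fin, Fintype.card_coe, hpivcard]
      push_cast; ring
    rw [hcard, Real.log_pow, Nat.cast_sub hL.length_le] at h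
    exact h
  -- (5) the parities
  have h5 := (ent_parities_le hq0 L).trans (sum_map_ent_oddOn_le hq0 hq1 L)
  -- assemble
  have : m * Real.log 2 - Real.log K ≤
      L.length * Real.log 2 - (L.map fun e => cubeFourierCoeff q e.1 ^ 2).sum / 2 +
        (m - L.length : ℝ) * Real.log 2 := by linarith
  linarith

end Entropy

/-! ### CLRS Lemma 3.3: the junta coordinates of a bounded density -/

/-- **Chan–Lee–Raghavendra–Steurer, Lemma 3.3 (junta set of a high-entropy density).**  For a
density `q : {0,1}^m → [0, K]` (`Σ q = 2^m`), every `d` and every `γ > 0` there is a set `J ⊆ [m]`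
with `|J| ≤ d · (2 log K)/γ²` such that `|q̂(α)| ≤ γ` for all `α ⊆ [m]` with `|α| ≤ d` and `α ⊄ J`.
(Printed for entropy `≥ n − t`, i.e. `K = 2^t`, with `|J| ≤ 2td/γ²`; see `ChanEtAl2016_lemma33_pow`.)
[cite: ChanEtAl2016, Lemma 3.3 (arXiv v3 p. 9)] -/
theorem ChanEtAl2016_lemma33 {q : (Fin m → Bool) → ℝ} (hq0 : ∀ x, 0 ≤ q x)
    (hq1 : ∑ x, q x = (2 : ℝ) ^ m) {K : ℝ} (hqK : ∀ x, q x ≤ K) (d : ℕ) {γ : ℝ} (hγ : 0 < γ) :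
    ∃ J : Finset (Fin m), (J.card : ℝ) ≤ d * (2 * Real.log K / γ ^ 2) ∧
      ∀ α : Finset (Fin m), α.card ≤ d → ¬ α ⊆ J → |cubeFourierCoeff q α| ≤ γ := by
  classical
  set F : Finset (Finset (Fin m)) :=
    univ.filter fun α => α.card ≤ d ∧ γ < |cubeFourierCoeff q α| with hF
  obtain ⟨L, hL, hLF, hcov⟩ := exists_triangular_cover F m ∅ (by simp)
  refine ⟨unionList (L.map Prod.fst), ?_, fun α hα hαJ => ?_⟩
  · -- `|J| ≤ d · |L|` and `|L| γ² ≤ Σ q̂² ≤ 2 log K`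
    have hc : (unionList (L.map Prod.fst)).card ≤ d * L.length := by
      have h := card_unionList_le (l := L.map Prod.fst) (d := d) fun a ha => by
        obtain ⟨e, he, rfl⟩ := List.mem_map.1 ha
        have := (hLF e he).1
        rw [hF, mem_filter] at this
        exact this.2.1
      simpa using h
    have hsum := sum_sq_cubeFourierCoeff_le_of_isTriangular hq0 hq1 hqK hL
    have hlen : (L.length : ℝ) * γ ^ 2 ≤ (L.map fun e => cubeFourierCoeff q e.1 ^ 2).sum := by
      have : ∀ e ∈ L, γ ^ 2 ≤ cubeFourierCoeff q e.1 ^ 2 := by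
        intro e he
        have h := (hLF e he).1
        rw [hF, mem_filter] at h
        have hγ' : γ < |cubeFourierCoeff q e.1| := h.2.2
        calc γ ^ 2 ≤ |cubeFourierCoeff q e.1| ^ 2 := by gcongr
          _ = cubeFourierCoeff q e.1 ^ 2 := sq_abs _
      clear hcov hLF hL hsum hc
      induction L with
      | nil => simp
      | cons e L ih =>
        simp only [List.map_cons, List.sum_cons, List.length_cons, Nat.cast_succ]
        have h1 := this e (by simp)
        have h2 := ih (fun e' he' => this e' (by simp [he']))
        linarith
    have hlen' : (L.length : ℝ) ≤ 2 * Real.log K / γ ^ 2 := by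
      rw [le_div_iff₀ (by positivity)]; linarith
    calc ((unionList (L.map Prod.fst)).card : ℝ) ≤ (d * L.length : ℕ) := by exact_mod_cast hc
      _ = d * (L.length : ℝ) := by push_cast; ring
      _ ≤ d * (2 * Real.log K / γ ^ 2) := by gcongr
  · by_contra hlt
    push Not at hlt
    have hαF : α ∈ F := by rw [hF, mem_filter]; exact ⟨mem_univ _, hα, hlt⟩
    have := hcov α hαF
    rw [empty_union] at this
    exact hαJ this

/-- **CLRS Lemma 3.3 in the printed currency** (`‖q‖_∞ ≤ 2^t`, entropy `≥ m − t`): a junta set of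
size `|J| ≤ 2td/γ²` (indeed `≤ 2td·ln 2/γ²`). [cite: ChanEtAl2016, Lemma 3.3 (arXiv v3 p. 9)] -/
theorem ChanEtAl2016_lemma33_pow {q : (Fin m → Bool) → ℝ} (hq0 : ∀ x, 0 ≤ q x)
    (hq1 : ∑ x, q x = (2 : ℝ) ^ m) {t : ℝ} (ht : 0 ≤ t) (hqt : ∀ x, q x ≤ (2 : ℝ) ^ t) (d : ℕ)
    {γ : ℝ} (hγ : 0 < γ) :
    ∃ J : Finset (Fin m), (J.card : ℝ) ≤ 2 * t * d / γ ^ 2 ∧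
      ∀ α : Finset (Fin m), α.card ≤ d → ¬ α ⊆ J → |cubeFourierCoeff q α| ≤ γ := by
  obtain ⟨J, hJ, h⟩ := ChanEtAl2016_lemma33 hq0 hq1 hqt d hγ
  refine ⟨J, hJ.trans ?_, h⟩
  have hlog : Real.log ((2 : ℝ) ^ t) ≤ t := by
    rw [Real.log_rpow two_pos]
    have := Real.log_two_lt_d9
    nlinarith
  calc (d : ℝ) * (2 * Real.log ((2 : ℝ) ^ t) / γ ^ 2) ≤ d * (2 * t / γ ^ 2) := by gcongr
    _ = 2 * t * d / γ ^ 2 := by ring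

end Literature.Probability.Moments

end
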